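/-
Copyright (c) 2026. All rights reserved.
Released under Apache 2.0 license as described in the file LICENSE.
Authors: HodgeCM publication cell (pub-hodgecm), GR lane, seat GR-2 (`pub-hodgecm-own-hyp34`).
-/
import Literature.NumberTheory.GelbartRogawski1991.Prop311PrintedDarbouxLegs
import Literature.NumberTheory.GelbartRogawski1991.Prop311PrintedTransportAlong
import HarnessLib

-- build-lane note (ops-buildfix G11b-3 recipe): dependent telescopes of the CM dual-pair datum; elaborate sequentially.
set_option Elab.async false

/-!
# [GelbartRogawski1991, Prop. 3.1.1] AS PRINTED from a leg over the Darboux frame, ALONG THE SECTION OF RECORD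

Topic `NumberTheory/GelbartRogawski1991`; namespace `Literature.NumberTheory.GelbartRogawski1991.Prop311`.  Proved lemmas
only; nothing of [GelbartRogawski1991] or [Weil1964] is asserted; `Prop311AsPrinted` is untouched.

The chain `Prop311PrintedDualPairLine` (J8) → `Prop311PrintedMpLeg` (J10a) → `Prop311PrintedCMLeg` (J10b) →
`Prop311PrintedDarbouxLegs` §3 (K2) derives the printed conclusion of Prop. 3.1.1 from the record on the tree's matrix
carriers and an `Mp` leg `φ₁ : Mp_ψ(𝐀ⁿ × 𝐀ⁿ, std)ᶜᵒⁿᵗ →* Mp_𝐀(W)` over the Darboux frame that is CONTINUOUS ON THE WHOLE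
GROUP `Mp_ψ(𝐀ⁿ × 𝐀ⁿ, std)ᶜᵒⁿᵗ` (coefficient topology) — i.e. the strong continuity of the adelic Weil representation
[Weil1964, Chap. III n° 39–43].  Print's clause (2) only needs the continuity of the COMPOSITE printed section
`φ₁ ∘ relabel ∘ s` for the compatible splitting `s` of record (along which locally uniform Schwartz–Bruhat majorants
are available, [Weil1964, Chap. III n° 41]).  This file re-threads the chain with that weaker input
(`Prop311PrintedTransportAlong.printed_conclusion_of_frame_along`):

* **`printed_conclusion_of_dualPairLine_along`** (J8): datum `pairLineDatum`, an explicit compatible `s`, `φ ∘ s`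
  continuous;
* **`printed_conclusion_of_darbouxLeg_along`** (J10a): a leg `φ₁` over `darbouxFrame b f e` (no continuity),
  `s` compatible for `pairLineDatum`, `g ↦ φ₁ (relabel (s g))` continuous;
* **`printed_conclusion_CM_of_darbouxLeg_along`** (J10b) and
  **`exists_isRationalSplitting_printed_conclusion_CM_of_darbouxLeg_along`** (K2 §3): the CM case — THE rational
  splitting `i` (exists, unique; `Prop311RationalSplittingExists`, no continuity needed) together with clauses (1)(2)
  verbatim, from a leg over the Darboux frame and an explicit compatible splitting of the CM dual-pair datum with
  continuous composite.  (The compatible splitting of record is `GRConstruction.gru_shape`'s; here it enters as an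
  explicit `s` so that its analytic structure — archimedean factor family, majorants — can be used for the continuity.)

## References
* [GelbartRogawski1991] S. Gelbart, J. Rogawski, Invent. Math. 105 (1991) 445–472, §3.1 p. 454 L17–42, Prop. 3.1.1
  p. 455 L1–2.
* [Weil1964] A. Weil, Acta Math. 111 (1964) 143–211, Chap. III n° 39–43.
-/

set_option autoImplicit false

noncomputable section

open NumberField
open scoped TensorProduct Matrix Kronecker
open Literature.NumberTheory.Automorphic
open Literature.NumberTheory.Automorphic.UnitaryGroup
open Literature.RepresentationTheory.HeisenbergGroup
open Literature.NumberTheory.Weil1964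

namespace Literature.NumberTheory.GelbartRogawski1991

namespace Prop311

open QuadraticCoordinates UnitaryDualPair

/-! ## §1. Any quadratic `E/F`: the dual-pair line datum and a leg over the Darboux frame, along the section -/

section Quadratic

variable (F : Type) [Field F] [NumberField F]
variable (E : Type) [Field E] [NumberField E] [Algebra F E] [Algebra.IsQuadraticExtension F E]
variable (σ : E ≃ₐ[F] E) {δ : E} (hσδ : σ δ = -δ) (hδ : δ ≠ 0) {d : F} (hd : δ * δ = algebraMap F E d)
variable (V : Type) [AddCommGroup V] [Module F V] [Module E V] [IsScalarTower F E V]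
variable {n : ℕ} (b : Module.Basis (Fin n) E V)
variable (Φ : V →ₗ[F] V →ₗ[F] E) (f : Fin n → F)
variable (e : Fin n × Fin 1 ≃ Fin n) (he : ∀ k : Fin n, (e.symm k).1 = k)
variable {S : Type} [NormedAddCommGroup S] [InnerProductSpace ℂ S]
variable (ρ : Representation ℂ (AdelicHeisenberg F E V Φ) S)
variable (i : ratSp F E V Φ →* adelicMp F E V Φ ρ) (hi : IsRationalSplitting F E V Φ ρ i)

include hi he in
/-- **J8 along the section**: [GelbartRogawski1991, Prop. 3.1.1] AS PRINTED from the dual-pair datum with line second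
factor — as `printed_conclusion_of_dualPairLine`, but with an EXPLICIT compatible splitting `s` of `pairLineDatum` and
continuity asked only of `g ↦ φ (s g)` (no continuity of `φ`). [cite: GelbartRogawski1991, §3.1 p. 454 L17–42; Prop. 3.1.1 p. 455 L1–2] -/
theorem printed_conclusion_of_dualPairLine_along
    (hΦ₁ : ∀ (e : E) (x y : V), Φ (e • x) y = e * Φ x y) (hΦ₂ : ∀ (e : E) (x y : V), Φ x (e • y) = Φ x y * σ e)
    (hb : ∀ i j, i ≠ j → Φ (b i) (b j) = 0) (hf : ∀ i, Φ (b i) (b i) = algebraMap F E (f i) * δ) (hf0 : ∀ i, f i ≠ 0)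
    (hi! : ∀ i' : ratSp F E V Φ →* adelicMp F E V Φ ρ, IsRationalSplitting F E V Φ ρ i' → i' = i)
    (hT : IsUnit (symplecticGram F d f).det)
    (φ : adelicMpCont F (Fin n) (UnitaryDualPair.adelicGram F e (symplecticGram F d f) (1 : Matrix (Fin 1) (Fin 1) F)) →*
      adelicMp F E V Φ ρ)
    (hproj : ∀ m,
      frameConj F E σ hσδ hδ hd V b ((proj F E V Φ ρ (φ m) : adelicSp F E V Φ) :
          AdelicSpace F V ≃ₗ[AdeleRing (𝓞 F) F] AdelicSpace F V) =
        ((adelicMpCont.proj F (Fin n)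
            (UnitaryDualPair.adelicGram F e (symplecticGram F d f) (1 : Matrix (Fin 1) (Fin 1) F)) m :
            symplecticGroup (polar (adelicForm F (Fin n)
              (UnitaryDualPair.adelicGram F e (symplecticGram F d f) (1 : Matrix (Fin 1) (Fin 1) F))))) :
          ((Fin n → AdeleRing (𝓞 F) F) × (Fin n → AdeleRing (𝓞 F) F)) ≃ₗ[AdeleRing (𝓞 F) F]
            ((Fin n → AdeleRing (𝓞 F) F) × (Fin n → AdeleRing (𝓞 F) F))))
    (h₀ : ∃ s, (pairLineDatum F E σ hσδ hδ hd f e hT).IsCompatible s ∧ Continuous fun g => φ (s g)) :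
    (∃ s : adelicUnitary F E V Φ →* adelicMp F E V Φ ρ,
        ∀ g : adelicUnitary F E V Φ,
          projEnd F E V Φ ρ (s g) =
            ((g : AdelicSpace F V ≃ₗ[AdeleRing (𝓞 F) F] AdelicSpace F V) :
              AdelicSpace F V →ₗ[AdeleRing (𝓞 F) F] AdelicSpace F V)) ∧
      ∃ s : adelicUnitary F E V Φ →* adelicMp F E V Φ ρ,
        Continuous s ∧
        (∀ g : adelicUnitary F E V Φ,
          projEnd F E V Φ ρ (s g) =
            ((g : AdelicSpace F V ≃ₗ[AdeleRing (𝓞 F) F] AdelicSpace F V) :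
              AdelicSpace F V →ₗ[AdeleRing (𝓞 F) F] AdelicSpace F V)) ∧
        ∀ g : adelicUnitary F E V Φ,
          IsRationalPoint F E V Φ (g : AdelicSpace F V ≃ₗ[AdeleRing (𝓞 F) F] AdelicSpace F V) → s g ∈ i.range := by
  -- a compatible splitting of `lineDatum` (big group re-read along `(adelicPairEquiv e)⁻¹`), continuous after `φ`
  obtain ⟨s, hs, hφs⟩ := h₀
  have hs' : (lineDatum F E σ hσδ hδ hd f e hT).IsCompatible
      (((MonoidHom.id _).comp s).comp (pairLineEquiv F E σ f e).symm.toMonoidHom) := by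
    refine SplittingDatum.IsCompatible.transport (D := pairLineDatum F E σ hσδ hδ hd f e hT)
      (D' := lineDatum F E σ hσδ hδ hd f e hT) (MonoidHom.id _) (MonoidHom.id _)
      (pairLineEquiv F E σ f e).symm.toMonoidHom (fun _ => rfl) (fun _ => rfl) ?_ ?_ hs
    · rintro _ ⟨γ, rfl⟩
      rw [MulEquiv.coe_toMonoidHom]
      exact adelicPairEquiv_symm_toAdelic_mem_range F E σ f e γ
    · intro x
      exact ⟨x, rfl⟩
  have hcont : Continuous fun g =>
      φ ((((MonoidHom.id _).comp s).comp (pairLineEquiv F E σ f e).symm.toMonoidHom) g) :=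
    hφs.comp (UnitaryGroup.continuous_adelicPairEquiv_symm F E σ n 1 e _ _)
  exact printed_conclusion_of_frame_along F E σ hσδ hδ hd V b Φ f ρ i hi hΦ₁ hΦ₂ hb hf hf0 hi!
    (reindex_kronecker_line F E f e he) (adelicGram_line F f e he)
    (UnitaryDualPair.isUnit_det_adelicGram F e hT (by rw [Matrix.det_one]; exact isUnit_one))
    (lineDatum F E σ hσδ hδ hd f e hT) (coe_lineDatum_toSp F E σ hσδ hδ hd f e he hT) rfl rfl φ hproj ⟨_, hs', hcont⟩

include hi he in
/-- **J10a along the section**: [GelbartRogawski1991, Prop. 3.1.1] AS PRINTED from a leg `φ₁` over the Darboux frame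
(a homomorphism `Mp_ψ(𝐀ⁿ × 𝐀ⁿ, std)ᶜᵒⁿᵗ →* Mp_𝐀(W)` over `darbouxFrame b f e`, NO continuity) and an explicit compatible
splitting `s` of `pairLineDatum` with `g ↦ φ₁ (relabel (s g))` continuous (`relabel` = the tree's
`adelicMpContRelabel` to the standard form, as in `mpLeg`). [cite: GelbartRogawski1991, §3.1 Prop. 3.1.1 p. 455 L1–2] -/
theorem printed_conclusion_of_darbouxLeg_along
    (hΦ₁ : ∀ (a : E) (x y : V), Φ (a • x) y = a * Φ x y) (hΦ₂ : ∀ (a : E) (x y : V), Φ x (a • y) = Φ x y * σ a)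
    (hb : ∀ i j, i ≠ j → Φ (b i) (b j) = 0) (hf : ∀ i, Φ (b i) (b i) = algebraMap F E (f i) * δ)
    (hφ : (traceForm F E V Φ).Nondegenerate)
    (hi! : ∀ i' : ratSp F E V Φ →* adelicMp F E V Φ ρ, IsRationalSplitting F E V Φ ρ i' → i' = i)
    (hT : IsUnit (symplecticGram F d f).det)
    (φ₁ : adelicMpCont F (Fin n) (1 : Matrix (Fin n) (Fin n) (AdeleRing (𝓞 F) F)) →* adelicMp F E V Φ ρ)
    (hproj₁ : ∀ (m₁ : adelicMpCont F (Fin n) (1 : Matrix (Fin n) (Fin n) (AdeleRing (𝓞 F) F)))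
        (c : (Fin n → AdeleRing (𝓞 F) F) × (Fin n → AdeleRing (𝓞 F) F)),
      ((proj F E V Φ ρ (φ₁ m₁) : adelicSp F E V Φ) : AdelicSpace F V ≃ₗ[AdeleRing (𝓞 F) F] AdelicSpace F V)
          (darbouxFrame F E σ hσδ hδ hd V b f e hT c) =
        darbouxFrame F E σ hσδ hδ hd V b f e hT
          (((adelicMpCont.proj F (Fin n) (1 : Matrix (Fin n) (Fin n) (AdeleRing (𝓞 F) F)) m₁ :
              symplecticGroup (polar (adelicForm F (Fin n) (1 : Matrix (Fin n) (Fin n) (AdeleRing (𝓞 F) F))))) :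
            ((Fin n → AdeleRing (𝓞 F) F) × (Fin n → AdeleRing (𝓞 F) F)) ≃ₗ[AdeleRing (𝓞 F) F]
              ((Fin n → AdeleRing (𝓞 F) F) × (Fin n → AdeleRing (𝓞 F) F))) c))
    (h₀ : ∃ s, (pairLineDatum F E σ hσδ hδ hd f e hT).IsCompatible s ∧
      Continuous fun g => φ₁ (adelicMpContRelabel F (Fin n) (legGL F f e hT) (one_mul_legGL F f e hT) (s g))) :
    (∃ s : adelicUnitary F E V Φ →* adelicMp F E V Φ ρ,
        ∀ g : adelicUnitary F E V Φ,
          projEnd F E V Φ ρ (s g) =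
            ((g : AdelicSpace F V ≃ₗ[AdeleRing (𝓞 F) F] AdelicSpace F V) :
              AdelicSpace F V →ₗ[AdeleRing (𝓞 F) F] AdelicSpace F V)) ∧
      ∃ s : adelicUnitary F E V Φ →* adelicMp F E V Φ ρ,
        Continuous s ∧
        (∀ g : adelicUnitary F E V Φ,
          projEnd F E V Φ ρ (s g) =
            ((g : AdelicSpace F V ≃ₗ[AdeleRing (𝓞 F) F] AdelicSpace F V) :
              AdelicSpace F V →ₗ[AdeleRing (𝓞 F) F] AdelicSpace F V)) ∧
        ∀ g : adelicUnitary F E V Φ,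
          IsRationalPoint F E V Φ (g : AdelicSpace F V ≃ₗ[AdeleRing (𝓞 F) F] AdelicSpace F V) → s g ∈ i.range :=
  printed_conclusion_of_dualPairLine_along F E σ hσδ hδ hd V b Φ f e he ρ i hi hΦ₁ hΦ₂ hb hf
    (frame_ne_zero_of_nondegenerate F E σ V b Φ f hΦ₁ hΦ₂ hb hf hφ) hi! hT (mpLeg F E V Φ f e hT ρ φ₁)
    (mpLeg_proj F E σ hσδ hδ hd V b Φ f e hT ρ φ₁ hproj₁) h₀

end Quadratic

/-! ## §2. CM data: THE rational splitting and the printed conclusion, along the section -/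

section CM

variable (L : Type) [Field L] [NumberField L] [IsCMField L]
variable {n : ℕ} (f : Fin n → ↥(maximalRealSubfield L))
variable (e : Fin n × Fin 1 ≃ Fin n) (he : ∀ k : Fin n, (e.symm k).1 = k)
-- `V` an `L`-space; its `L⁺`-structure is Mathlib's restriction (no separate binder).
variable (V : Type) [AddCommGroup V] [Module L V]
variable (b : Module.Basis (Fin n) L V) (Φ : V →ₗ[↥(maximalRealSubfield L)] V →ₗ[↥(maximalRealSubfield L)] L)
variable {S : Type} [NormedAddCommGroup S] [InnerProductSpace ℂ S]
variable (ρ : Representation ℂ (AdelicHeisenberg (↥(maximalRealSubfield L)) L V Φ) S)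

section GivenSplitting

variable (i : ratSp (↥(maximalRealSubfield L)) L V Φ →* adelicMp (↥(maximalRealSubfield L)) L V Φ ρ)
variable (hi : IsRationalSplitting (↥(maximalRealSubfield L)) L V Φ ρ i)

include hi he in
/-- **J10b along the section**: [GelbartRogawski1991, Prop. 3.1.1] AS PRINTED AT CM DATA (`F = L⁺`, `E = L`, `σ` complex
conjugation, `δ = imagUnit L`) from a leg `φ₁` over the Darboux frame (no continuity) and an explicit compatible splitting
`s` of the CM dual-pair line datum with `g ↦ φ₁ (relabel (s g))` continuous; `i` THE rational splitting.
[cite: GelbartRogawski1991, §3.1 p. 454 L17–42; Prop. 3.1.1 p. 455 L1–2] -/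
theorem printed_conclusion_CM_of_darbouxLeg_along
    (hΦ₁ : ∀ (a : L) (x y : V), Φ (a • x) y = a * Φ x y)
    (hΦ₂ : ∀ (a : L) (x y : V), Φ x (a • y) = Φ x y * IsCMField.complexConj L a)
    (hb : ∀ i j, i ≠ j → Φ (b i) (b j) = 0)
    (hf : ∀ i, Φ (b i) (b i) = algebraMap (↥(maximalRealSubfield L)) L (f i) * imagUnit L)
    (hφ : (traceForm (↥(maximalRealSubfield L)) L V Φ).Nondegenerate)
    (hi! : ∀ i' : ratSp (↥(maximalRealSubfield L)) L V Φ →* adelicMp (↥(maximalRealSubfield L)) L V Φ ρ,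
      IsRationalSplitting (↥(maximalRealSubfield L)) L V Φ ρ i' → i' = i)
    (φ₁ : adelicMpCont (↥(maximalRealSubfield L)) (Fin n)
        (1 : Matrix (Fin n) (Fin n) (AdeleRing (𝓞 ↥(maximalRealSubfield L)) ↥(maximalRealSubfield L))) →*
      adelicMp (↥(maximalRealSubfield L)) L V Φ ρ)
    (hproj₁ : ∀ (m₁ : adelicMpCont (↥(maximalRealSubfield L)) (Fin n)
          (1 : Matrix (Fin n) (Fin n) (AdeleRing (𝓞 ↥(maximalRealSubfield L)) ↥(maximalRealSubfield L))))
        (c : (Fin n → AdeleRing (𝓞 ↥(maximalRealSubfield L)) ↥(maximalRealSubfield L)) ×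
          (Fin n → AdeleRing (𝓞 ↥(maximalRealSubfield L)) ↥(maximalRealSubfield L))),
      ((proj (↥(maximalRealSubfield L)) L V Φ ρ (φ₁ m₁) : adelicSp (↥(maximalRealSubfield L)) L V Φ) :
            AdelicSpace (↥(maximalRealSubfield L)) V ≃ₗ[AdeleRing (𝓞 ↥(maximalRealSubfield L)) ↥(maximalRealSubfield L)]
              AdelicSpace (↥(maximalRealSubfield L)) V)
          (darbouxFrame (↥(maximalRealSubfield L)) L (IsCMField.complexConj L) (complexConj_imagUnit L)
            (imagUnit_ne_zero L) (imagUnit_mul_self L) V b f e (isUnit_det_cmLineGram_of_nondegenerate L f V b Φ hΦ₁ hΦ₂ hb hf hφ) c) =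
        darbouxFrame (↥(maximalRealSubfield L)) L (IsCMField.complexConj L) (complexConj_imagUnit L)
            (imagUnit_ne_zero L) (imagUnit_mul_self L) V b f e (isUnit_det_cmLineGram_of_nondegenerate L f V b Φ hΦ₁ hΦ₂ hb hf hφ)
          (((adelicMpCont.proj (↥(maximalRealSubfield L)) (Fin n)
                (1 : Matrix (Fin n) (Fin n) (AdeleRing (𝓞 ↥(maximalRealSubfield L)) ↥(maximalRealSubfield L))) m₁ :
              symplecticGroup (polar (adelicForm (↥(maximalRealSubfield L)) (Fin n)
                (1 : Matrix (Fin n) (Fin n) (AdeleRing (𝓞 ↥(maximalRealSubfield L)) ↥(maximalRealSubfield L)))))) :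
            ((Fin n → AdeleRing (𝓞 ↥(maximalRealSubfield L)) ↥(maximalRealSubfield L)) ×
                (Fin n → AdeleRing (𝓞 ↥(maximalRealSubfield L)) ↥(maximalRealSubfield L))) ≃ₗ[
                AdeleRing (𝓞 ↥(maximalRealSubfield L)) ↥(maximalRealSubfield L)]
              ((Fin n → AdeleRing (𝓞 ↥(maximalRealSubfield L)) ↥(maximalRealSubfield L)) ×
                (Fin n → AdeleRing (𝓞 ↥(maximalRealSubfield L)) ↥(maximalRealSubfield L)))) c))
    (h₀ : ∃ s, (pairLineDatum (↥(maximalRealSubfield L)) L (IsCMField.complexConj L) (complexConj_imagUnit L)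
        (imagUnit_ne_zero L) (imagUnit_mul_self L) f e (isUnit_det_cmLineGram_of_nondegenerate L f V b Φ hΦ₁ hΦ₂ hb hf hφ)).IsCompatible s ∧
      Continuous fun g => φ₁ (adelicMpContRelabel (↥(maximalRealSubfield L)) (Fin n)
        (legGL (↥(maximalRealSubfield L)) f e (isUnit_det_cmLineGram_of_nondegenerate L f V b Φ hΦ₁ hΦ₂ hb hf hφ))
        (one_mul_legGL (↥(maximalRealSubfield L)) f e (isUnit_det_cmLineGram_of_nondegenerate L f V b Φ hΦ₁ hΦ₂ hb hf hφ)) (s g))) :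
    (∃ s : adelicUnitary (↥(maximalRealSubfield L)) L V Φ →* adelicMp (↥(maximalRealSubfield L)) L V Φ ρ,
        ∀ g : adelicUnitary (↥(maximalRealSubfield L)) L V Φ,
          projEnd (↥(maximalRealSubfield L)) L V Φ ρ (s g) =
            ((g : AdelicSpace (↥(maximalRealSubfield L)) V ≃ₗ[AdeleRing (𝓞 ↥(maximalRealSubfield L)) ↥(maximalRealSubfield L)]
                AdelicSpace (↥(maximalRealSubfield L)) V) :
              AdelicSpace (↥(maximalRealSubfield L)) V →ₗ[AdeleRing (𝓞 ↥(maximalRealSubfield L)) ↥(maximalRealSubfield L)]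
                AdelicSpace (↥(maximalRealSubfield L)) V)) ∧
      ∃ s : adelicUnitary (↥(maximalRealSubfield L)) L V Φ →* adelicMp (↥(maximalRealSubfield L)) L V Φ ρ,
        Continuous s ∧
        (∀ g : adelicUnitary (↥(maximalRealSubfield L)) L V Φ,
          projEnd (↥(maximalRealSubfield L)) L V Φ ρ (s g) =
            ((g : AdelicSpace (↥(maximalRealSubfield L)) V ≃ₗ[AdeleRing (𝓞 ↥(maximalRealSubfield L)) ↥(maximalRealSubfield L)]
                AdelicSpace (↥(maximalRealSubfield L)) V) :
              AdelicSpace (↥(maximalRealSubfield L)) V →ₗ[AdeleRing (𝓞 ↥(maximalRealSubfield L)) ↥(maximalRealSubfield L)]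
                AdelicSpace (↥(maximalRealSubfield L)) V)) ∧
        ∀ g : adelicUnitary (↥(maximalRealSubfield L)) L V Φ,
          IsRationalPoint (↥(maximalRealSubfield L)) L V Φ
              (g : AdelicSpace (↥(maximalRealSubfield L)) V ≃ₗ[AdeleRing (𝓞 ↥(maximalRealSubfield L)) ↥(maximalRealSubfield L)]
                AdelicSpace (↥(maximalRealSubfield L)) V) →
            s g ∈ i.range :=
  printed_conclusion_of_darbouxLeg_along (↥(maximalRealSubfield L)) L (IsCMField.complexConj L) (complexConj_imagUnit L)
    (imagUnit_ne_zero L) (imagUnit_mul_self L) V b Φ f e he ρ i hi hΦ₁ hΦ₂ hb hf hφ hi!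
    (isUnit_det_cmLineGram_of_nondegenerate L f V b Φ hΦ₁ hΦ₂ hb hf hφ) φ₁ hproj₁ h₀

end GivenSplitting

variable [CompleteSpace S]

include he in
/-- **K2 §3 along the section**: at CM data in a given frame, from ONE leg over the Darboux frame (no continuity) and an
explicit compatible splitting of the CM dual-pair line datum with continuous composite: THE rational splitting `i`
(exists — `exists_isRationalSplitting_of_darbouxLeg`, no continuity used; unique — `rationalSplitting_unique'`) together
with clauses (1) and (2) of Prop. 3.1.1 verbatim, i.e. the binders `(i, _hi, _hi!)` AND the conclusion of
`Prop311AsPrinted` at this model. [cite: GelbartRogawski1991, §3.1 p. 454 L35–36; Prop. 3.1.1 p. 455 L1–2] -/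
theorem exists_isRationalSplitting_printed_conclusion_CM_of_darbouxLeg_along
    (hΦ₁ : ∀ (a : L) (x y : V), Φ (a • x) y = a * Φ x y)
    (hΦ₂ : ∀ (a : L) (x y : V), Φ x (a • y) = Φ x y * IsCMField.complexConj L a)
    (hΦ₃ : ∀ x y : V, Φ y x = -IsCMField.complexConj L (Φ x y))
    (hb : ∀ i j, i ≠ j → Φ (b i) (b j) = 0)
    (hf : ∀ i, Φ (b i) (b i) = algebraMap (↥(maximalRealSubfield L)) L (f i) * imagUnit L)
    (hφ : (traceForm (↥(maximalRealSubfield L)) L V Φ).Nondegenerate)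
    (hρu : ∀ (h : AdelicHeisenberg (↥(maximalRealSubfield L)) L V Φ) (v : S), ‖ρ h v‖ = ‖v‖)
    (hρi : ∀ K : Submodule ℂ S, IsClosed (K : Set S) →
      (∀ (h : AdelicHeisenberg (↥(maximalRealSubfield L)) L V Φ), ∀ v ∈ K, ρ h v ∈ K) → K = ⊥ ∨ K = ⊤)
    (φ₁ : adelicMpCont (↥(maximalRealSubfield L)) (Fin n)
        (1 : Matrix (Fin n) (Fin n) (AdeleRing (𝓞 ↥(maximalRealSubfield L)) ↥(maximalRealSubfield L))) →*
      adelicMp (↥(maximalRealSubfield L)) L V Φ ρ)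
    (hproj₁ : ∀ (m₁ : adelicMpCont (↥(maximalRealSubfield L)) (Fin n)
          (1 : Matrix (Fin n) (Fin n) (AdeleRing (𝓞 ↥(maximalRealSubfield L)) ↥(maximalRealSubfield L))))
        (c : (Fin n → AdeleRing (𝓞 ↥(maximalRealSubfield L)) ↥(maximalRealSubfield L)) ×
          (Fin n → AdeleRing (𝓞 ↥(maximalRealSubfield L)) ↥(maximalRealSubfield L))),
      ((proj (↥(maximalRealSubfield L)) L V Φ ρ (φ₁ m₁) : adelicSp (↥(maximalRealSubfield L)) L V Φ) :
            AdelicSpace (↥(maximalRealSubfield L)) V ≃ₗ[AdeleRing (𝓞 ↥(maximalRealSubfield L)) ↥(maximalRealSubfield L)]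
              AdelicSpace (↥(maximalRealSubfield L)) V)
          (darbouxFrame (↥(maximalRealSubfield L)) L (IsCMField.complexConj L) (complexConj_imagUnit L)
            (imagUnit_ne_zero L) (imagUnit_mul_self L) V b f e (isUnit_det_cmLineGram_of_nondegenerate L f V b Φ hΦ₁ hΦ₂ hb hf hφ) c) =
        darbouxFrame (↥(maximalRealSubfield L)) L (IsCMField.complexConj L) (complexConj_imagUnit L)
            (imagUnit_ne_zero L) (imagUnit_mul_self L) V b f e (isUnit_det_cmLineGram_of_nondegenerate L f V b Φ hΦ₁ hΦ₂ hb hf hφ)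
          (((adelicMpCont.proj (↥(maximalRealSubfield L)) (Fin n)
                (1 : Matrix (Fin n) (Fin n) (AdeleRing (𝓞 ↥(maximalRealSubfield L)) ↥(maximalRealSubfield L))) m₁ :
              symplecticGroup (polar (adelicForm (↥(maximalRealSubfield L)) (Fin n)
                (1 : Matrix (Fin n) (Fin n) (AdeleRing (𝓞 ↥(maximalRealSubfield L)) ↥(maximalRealSubfield L)))))) :
            ((Fin n → AdeleRing (𝓞 ↥(maximalRealSubfield L)) ↥(maximalRealSubfield L)) ×
                (Fin n → AdeleRing (𝓞 ↥(maximalRealSubfield L)) ↥(maximalRealSubfield L))) ≃ₗ[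
                AdeleRing (𝓞 ↥(maximalRealSubfield L)) ↥(maximalRealSubfield L)]
              ((Fin n → AdeleRing (𝓞 ↥(maximalRealSubfield L)) ↥(maximalRealSubfield L)) ×
                (Fin n → AdeleRing (𝓞 ↥(maximalRealSubfield L)) ↥(maximalRealSubfield L)))) c))
    (h₀ : ∃ s, (pairLineDatum (↥(maximalRealSubfield L)) L (IsCMField.complexConj L) (complexConj_imagUnit L)
        (imagUnit_ne_zero L) (imagUnit_mul_self L) f e (isUnit_det_cmLineGram_of_nondegenerate L f V b Φ hΦ₁ hΦ₂ hb hf hφ)).IsCompatible s ∧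
      Continuous fun g => φ₁ (adelicMpContRelabel (↥(maximalRealSubfield L)) (Fin n)
        (legGL (↥(maximalRealSubfield L)) f e (isUnit_det_cmLineGram_of_nondegenerate L f V b Φ hΦ₁ hΦ₂ hb hf hφ))
        (one_mul_legGL (↥(maximalRealSubfield L)) f e (isUnit_det_cmLineGram_of_nondegenerate L f V b Φ hΦ₁ hΦ₂ hb hf hφ)) (s g))) :
    ∃ i : ratSp (↥(maximalRealSubfield L)) L V Φ →* adelicMp (↥(maximalRealSubfield L)) L V Φ ρ,
      IsRationalSplitting (↥(maximalRealSubfield L)) L V Φ ρ i ∧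
      (∀ i' : ratSp (↥(maximalRealSubfield L)) L V Φ →* adelicMp (↥(maximalRealSubfield L)) L V Φ ρ,
        IsRationalSplitting (↥(maximalRealSubfield L)) L V Φ ρ i' → i' = i) ∧
      (∃ s : adelicUnitary (↥(maximalRealSubfield L)) L V Φ →* adelicMp (↥(maximalRealSubfield L)) L V Φ ρ,
          ∀ g : adelicUnitary (↥(maximalRealSubfield L)) L V Φ,
            projEnd (↥(maximalRealSubfield L)) L V Φ ρ (s g) =
              ((g : AdelicSpace (↥(maximalRealSubfield L)) V ≃ₗ[AdeleRing (𝓞 ↥(maximalRealSubfield L)) ↥(maximalRealSubfield L)]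
                  AdelicSpace (↥(maximalRealSubfield L)) V) :
                AdelicSpace (↥(maximalRealSubfield L)) V →ₗ[AdeleRing (𝓞 ↥(maximalRealSubfield L)) ↥(maximalRealSubfield L)]
                  AdelicSpace (↥(maximalRealSubfield L)) V)) ∧
        ∃ s : adelicUnitary (↥(maximalRealSubfield L)) L V Φ →* adelicMp (↥(maximalRealSubfield L)) L V Φ ρ,
          Continuous s ∧
          (∀ g : adelicUnitary (↥(maximalRealSubfield L)) L V Φ,
            projEnd (↥(maximalRealSubfield L)) L V Φ ρ (s g) =
              ((g : AdelicSpace (↥(maximalRealSubfield L)) V ≃ₗ[AdeleRing (𝓞 ↥(maximalRealSubfield L)) ↥(maximalRealSubfield L)]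
                  AdelicSpace (↥(maximalRealSubfield L)) V) :
                AdelicSpace (↥(maximalRealSubfield L)) V →ₗ[AdeleRing (𝓞 ↥(maximalRealSubfield L)) ↥(maximalRealSubfield L)]
                  AdelicSpace (↥(maximalRealSubfield L)) V)) ∧
          ∀ g : adelicUnitary (↥(maximalRealSubfield L)) L V Φ,
            IsRationalPoint (↥(maximalRealSubfield L)) L V Φ
                (g : AdelicSpace (↥(maximalRealSubfield L)) V ≃ₗ[AdeleRing (𝓞 ↥(maximalRealSubfield L)) ↥(maximalRealSubfield L)]
                  AdelicSpace (↥(maximalRealSubfield L)) V) →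
              s g ∈ i.range := by
  haveI : FiniteDimensional L V := Module.Finite.of_basis b
  have hex := exists_isRationalSplitting_of_darbouxLeg (↥(maximalRealSubfield L)) L (IsCMField.complexConj L)
    (complexConj_imagUnit L) (imagUnit_ne_zero L) (imagUnit_mul_self L) V b Φ f ρ e he hΦ₁ hΦ₂ hb hf hφ
    (isUnit_det_cmLineGram_of_nondegenerate L f V b Φ hΦ₁ hΦ₂ hb hf hφ) φ₁ hproj₁
  obtain ⟨i, hi⟩ := hex
  have hi! : ∀ i' : ratSp (↥(maximalRealSubfield L)) L V Φ →* adelicMp (↥(maximalRealSubfield L)) L V Φ ρ,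
      IsRationalSplitting (↥(maximalRealSubfield L)) L V Φ ρ i' → i' = i := fun i' hi' =>
    rationalSplitting_unique' (↥(maximalRealSubfield L)) L V Φ ρ (IsCMField.complexConj L) hΦ₃ hφ hρu hρi i i' hi hi'
  exact ⟨i, hi, hi!, printed_conclusion_CM_of_darbouxLeg_along L f e he V b Φ ρ i hi hΦ₁ hΦ₂ hb hf hφ hi! φ₁ hproj₁ h₀⟩

end CM

end Prop311

end Literature.NumberTheory.GelbartRogawski1991

end
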